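/-
Copyright (c) 2026 the pub-hodgecm-mathlib formalisation cell (harness21).  Prover seat hodgecm-mathlib-B-p04 (g47): LH4-plan (g6) WORD #21 FILE A (O8a-∃′, the uniform
«linear symmetriser» of the good-vector criterion; memo `MEMO-M4-wild-parity.v1.B-p04g47.md` §2); 2026-09-02.
-/
import Literature.NumberTheory.Automorphic.SplitTorusOrderNormCriterion     -- ★ O8a-∃ (tame, Cayley symmetriser) and O7 `eval_mem_span_pow` (`O[γ]` contains polynomial values)
import HarnessLib

/-!
# T3′ organ O8a-∃′ — the LINEAR SYMMETRISER: `T(a) = (c₀ + c₁γᵢ)ᵢ` with `c₀, c₁ ∈ O` and unit values is GOOD, at EVERY residue characteristic; for norm-one nodes on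
# `Fin 3` the σ-compatible linear family is `p(X) = ω + σ(ω)·G·X`, `G = γ₀γ₁γ₂` (Jacobowitz 1962 §4; Rogawski 1990 §4.9; Serre V §2)

Topic `NumberTheory/Automorphic`; namespace `Literature.NumberTheory.Automorphic`.  THEOREMS ONLY (no definition, no instance, no notation, no named fact, no `sorry`); generic
field algebra; kernel lane `--supports stmt-HodgeConjecture-24833`.  Cell `pub/hodgecm-mathlib` (D-0151), crux H413 = `stmt-HodgeConjecture-24833`; half A line LH4 (M4 wall of
census F0P3a-p06 (g17) `DUNR-H2-CENSUS`), LH4-plan (g6) WORD #21 FILE A, after B-p04 (g47)'s memo `F0/P3c/LH4/B-p04-g47/MEMO-M4-wild-parity.v1.B-p04g47.md` §2.  A SIBLING of ★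
O8a-∃ `SplitTorusOrderNormCriterion.exists_criterion_of_norm_solutions`, whose CAYLEY symmetriser `λ = ((1+γ)δ)^{n−1}·P₀·(1+γ)⁻¹` needs the binders `1 + γᵢ ∈ O^×`
(`hγ1u`) and a skew unit `δ` — the first fails as soon as `|2| < 1` (`γᵢ ≡ 1 ⇒ 1 + γᵢ ≡ 2`).  HONEST LABEL: HC_CM is proved only modulo the 7 printed citations (2 remaining
named inputs: hLiu418 = stmt-HodgeConjecture-24832, h413 = stmt-HodgeConjecture-24833) until rung 0 closes; count-neutral (pays no organ, opens no road).

THE MATHEMATICS.  ★ O7∕O8a currency: `K` a field, `O ⊆ K` a subring, `σ : K →+* K`, nodes `γ : Fin n → K` in `O`, `R := span_O{(γᵢ^j)ᵢ}`, criterion vector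
`T(a)ᵢ := dᵢ·aᵢσ(aᵢ)·Vᵢ`, `Vᵢ := ∏_{j≠i}(γᵢ − γⱼ)`; GOOD(a) := «`T(a) ∈ R` with unit components».  (§1) If `T(a)ᵢ = c₀ + c₁·γᵢ` for all `i` with `c₀, c₁ ∈ O` and unit values,
then `a` is GOOD — `T(a)` is the VALUE VECTOR of the `O`-polynomial `c₀ + c₁X` (★ `eval_mem_span_pow`).  This is residue-characteristic-free: no Cayley transform, no `δ`.  (§2)
For NORM-ONE nodes on `Fin 3` (`σγᵢ = γᵢ⁻¹`): `σVᵢ = Vᵢ∕(γᵢ·G)` with `G := γ₀γ₁γ₂`, so the requirement «`T(a)ᵢ∕dᵢ = aᵢσaᵢ` is σ-fixed» is met by the linear family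
**`p(X) = ω + σ(ω)·G·X`** (any `ω`; `σ² = 1`): `σ(p(γᵢ)∕(dᵢVᵢ)) = p(γᵢ)∕(dᵢVᵢ)` — the norm equations `aᵢσ(aᵢ) = p(γᵢ)∕(dᵢVᵢ)` have σ-FIXED right-hand sides (§2), and the
rationality involution `ι` (fixing `γ₀, ω, σω`, swapping `γ₁, γ₂`) fixes `p(γ₀)` and swaps `p(γ₁), p(γ₂)` (§3).  The tame ★ symmetriser is the member `ω = P₀δ²` (values
`P₀δ²(1 + γᵢ)`); at a dyadic place one takes `ω` with `ω + σω` a unit (the values are `≡ ω + σω` in the depth-zero regime `γᵢ ≡ 1`) — supplied by the consumer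
(`RationalGoodVectorParityUniform`, FILE B), which also discharges the unit hypothesis in its valued setting.

## References
* [Jacobowitz1962] R. Jacobowitz, *Hermitian forms over local fields*, Amer. J. Math. 84 (1962): §4 (Gram criteria for lattices), §7.
* [Rogawski1990] J. D. Rogawski, *Automorphic Representations of Unitary Groups in Three Variables* (1990): §4.9 Lemma 4.9.3 p. 56 (where the count is consumed).
* [Serre1979] J.-P. Serre, *Local Fields*, GTM 67 (1979): Ch. III §6 (orders `O[γ]`), Ch. V §2 Prop. 3 (norm equations at an unramified extension).
-/

set_option autoImplicit false

open Polynomial Finset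

namespace Literature.NumberTheory.Automorphic

/-! ## §1 Linear values are GOOD (any `n`, any residue characteristic) -/

section Linear

variable {K : Type*} [Field K] {n : ℕ} (O : Subring K) (σ : K →+* K) {γ : Fin n → K}

/-- **The value vector `(c₀ + c₁γᵢ)ᵢ` of an `O`-linear polynomial lies in `R = O[γ]`** (★ O7 `eval_mem_span_pow` at `C c₀ + C c₁·X`). [cite: Serre1979, Ch. III §6] -/
theorem linearValues_mem_span_pow (hγ : ∀ i, γ i ∈ O) {c₀ c₁ : K} (hc₀ : c₀ ∈ O) (hc₁ : c₁ ∈ O) :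
    (fun i => c₀ + c₁ * γ i) ∈ Submodule.span O (Set.range fun j : Fin n => fun i => γ i ^ (j : ℕ)) := by
  have h := eval_mem_span_pow O hγ (γ := γ) (C (⟨c₀, hc₀⟩ : O) + C (⟨c₁, hc₁⟩ : O) * X)
  have he : (fun i => ((C (⟨c₀, hc₀⟩ : O) + C (⟨c₁, hc₁⟩ : O) * X).map O.subtype).eval (γ i)) = fun i => c₀ + c₁ * γ i := by
    funext i; simp
  rwa [he] at h

/-- **O8a-∃′ — THE LINEAR SYMMETRISER MAKES `a` GOOD**: if the criterion vector has the values of an `O`-linear polynomial, `dᵢ·aᵢσ(aᵢ)·∏_{j≠i}(γᵢ − γⱼ) = c₀ + c₁γᵢ` with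
`c₀, c₁ ∈ O`, and these values are units of `O`, then `T(a) ∈ R` with unit components — ★ O8a-∃'s GOOD token, WITHOUT `1 + γᵢ ∈ O^×` and WITHOUT a skew unit `δ`.
[cite: Jacobowitz1962, §4] [cite: Rogawski1990, §4.9 Lemma 4.9.3 p. 56] [cite: Serre1979, Ch. III §6] -/
theorem exists_criterion_of_linear_values (hγ : ∀ i, γ i ∈ O) {c₀ c₁ : K} (hc₀ : c₀ ∈ O) (hc₁ : c₁ ∈ O) (d a : Fin n → K)
    (ha : ∀ i, d i * a i * σ (a i) * ∏ j ∈ univ.erase i, (γ i - γ j) = c₀ + c₁ * γ i) (hu : ∀ i, ∃ y ∈ O, y * (c₀ + c₁ * γ i) = 1) :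
    (fun i => d i * a i * σ (a i) * ∏ j ∈ univ.erase i, (γ i - γ j)) ∈ Submodule.span O (Set.range fun j : Fin n => fun i => γ i ^ (j : ℕ)) ∧
      ∀ i, ∃ y ∈ O, y * (d i * a i * σ (a i) * ∏ j ∈ univ.erase i, (γ i - γ j)) = 1 := by
  have hT : (fun i => d i * a i * σ (a i) * ∏ j ∈ univ.erase i, (γ i - γ j)) = fun i => c₀ + c₁ * γ i := funext ha
  refine ⟨by rw [hT]; exact linearValues_mem_span_pow O hγ hc₀ hc₁, fun i => ?_⟩
  rw [ha i]; exact hu i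

/-- **O8a-∃′ in NORM-EQUATION shape**: if `aᵢσ(aᵢ)·(dᵢVᵢ) = c₀ + c₁γᵢ` (the `n` norm equations with right-hand sides `(c₀ + c₁γᵢ)∕(dᵢVᵢ)` SOLVED), `c₀, c₁ ∈ O`, unit values, then
`a` is GOOD. [cite: Jacobowitz1962, §4] [cite: Serre1979, Ch. V §2 Prop. 3] -/
theorem exists_criterion_of_linear_norm_solutions (hγ : ∀ i, γ i ∈ O) {c₀ c₁ : K} (hc₀ : c₀ ∈ O) (hc₁ : c₁ ∈ O) (d a : Fin n → K)
    (ha : ∀ i, a i * σ (a i) * (d i * ∏ j ∈ univ.erase i, (γ i - γ j)) = c₀ + c₁ * γ i) (hu : ∀ i, ∃ y ∈ O, y * (c₀ + c₁ * γ i) = 1) :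
    (fun i => d i * a i * σ (a i) * ∏ j ∈ univ.erase i, (γ i - γ j)) ∈ Submodule.span O (Set.range fun j : Fin n => fun i => γ i ^ (j : ℕ)) ∧
      ∀ i, ∃ y ∈ O, y * (d i * a i * σ (a i) * ∏ j ∈ univ.erase i, (γ i - γ j)) = 1 :=
  exists_criterion_of_linear_values O σ hγ hc₀ hc₁ d a (fun i => by rw [← ha i]; ring) hu

/-- **CONVERSE (trivial half)**: a GOOD `a` has every `T(a)ᵢ = dᵢ·aᵢσ(aᵢ)·Vᵢ` a unit of `O` — the second GOOD clause itself; recorded for symmetry with ★ O8a-∃'s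
`isUnit_normSymm_of_criterion` (there the Cayley-normalised quantity). [cite: Jacobowitz1962, §4] -/
theorem criterion_apply_mem_and_unit_of_good (hγ : ∀ i, γ i ∈ O) (d a : Fin n → K)
    (hgood : (fun i => d i * a i * σ (a i) * ∏ j ∈ univ.erase i, (γ i - γ j)) ∈ Submodule.span O (Set.range fun j : Fin n => fun i => γ i ^ (j : ℕ)) ∧
      ∀ i, ∃ y ∈ O, y * (d i * a i * σ (a i) * ∏ j ∈ univ.erase i, (γ i - γ j)) = 1) (i : Fin n) :
    d i * a i * σ (a i) * ∏ j ∈ univ.erase i, (γ i - γ j) ∈ O ∧ ∃ y ∈ O, y * (d i * a i * σ (a i) * ∏ j ∈ univ.erase i, (γ i - γ j)) = 1 :=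
  ⟨apply_mem_of_mem_span_pow O hγ hgood.1 i, hgood.2 i⟩

end Linear

/-! ## §2 Norm-one nodes on `Fin 3`: `σVᵢ = Vᵢ∕(γᵢG)` and the σ-compatible linear family `ω + σ(ω)·G·X` -/

section NormOne

variable {K : Type*} [Field K] (σ : K →+* K) {γ : Fin 3 → K}

/-- `∏_{j ≠ 0} f j = f 1 · f 2` on `Fin 3`. [folklore] -/
private theorem prod_erase_zero_three' {M : Type*} [CommMonoid M] (f : Fin 3 → M) : ∏ j ∈ univ.erase (0 : Fin 3), f j = f 1 * f 2 := by
  rw [show univ.erase (0 : Fin 3) = {1, 2} by decide, Finset.prod_pair (by decide)]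

/-- `∏_{j ≠ 1} f j = f 0 · f 2` on `Fin 3`. [folklore] -/
private theorem prod_erase_one_three' {M : Type*} [CommMonoid M] (f : Fin 3 → M) : ∏ j ∈ univ.erase (1 : Fin 3), f j = f 0 * f 2 := by
  rw [show univ.erase (1 : Fin 3) = {0, 2} by decide, Finset.prod_pair (by decide)]

/-- `∏_{j ≠ 2} f j = f 0 · f 1` on `Fin 3`. [folklore] -/
private theorem prod_erase_two_three' {M : Type*} [CommMonoid M] (f : Fin 3 → M) : ∏ j ∈ univ.erase (2 : Fin 3), f j = f 0 * f 1 := by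
  rw [show univ.erase (2 : Fin 3) = {0, 1} by decide, Finset.prod_pair (by decide)]

/-- **`σVᵢ = Vᵢ ∕ (γᵢ·G)`** for norm-one nodes on `Fin 3` (`σγⱼ = γⱼ⁻¹`): `σ(γᵢ − γⱼ) = −(γᵢ − γⱼ)∕(γᵢγⱼ)`, two factors, `G = γ₀γ₁γ₂`. [cite: Jacobowitz1962, §4] -/
theorem map_nodalDeriv_fin_three (hσγ : ∀ i, σ (γ i) = (γ i)⁻¹) (hγ0 : ∀ i, γ i ≠ 0) (i : Fin 3) :
    σ (∏ j ∈ univ.erase i, (γ i - γ j)) = (∏ j ∈ univ.erase i, (γ i - γ j)) / (γ i * (γ 0 * γ 1 * γ 2)) := by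
  have h0 := hγ0 0; have h1 := hγ0 1; have h2 := hγ0 2
  fin_cases i
  · show σ (∏ j ∈ univ.erase (0 : Fin 3), (γ 0 - γ j)) = (∏ j ∈ univ.erase (0 : Fin 3), (γ 0 - γ j)) / (γ 0 * (γ 0 * γ 1 * γ 2))
    rw [prod_erase_zero_three' (fun j => γ 0 - γ j), map_mul, map_sub, map_sub, hσγ, hσγ, hσγ]
    field_simp; ring
  · show σ (∏ j ∈ univ.erase (1 : Fin 3), (γ 1 - γ j)) = (∏ j ∈ univ.erase (1 : Fin 3), (γ 1 - γ j)) / (γ 1 * (γ 0 * γ 1 * γ 2))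
    rw [prod_erase_one_three' (fun j => γ 1 - γ j), map_mul, map_sub, map_sub, hσγ, hσγ, hσγ]
    field_simp; ring
  · show σ (∏ j ∈ univ.erase (2 : Fin 3), (γ 2 - γ j)) = (∏ j ∈ univ.erase (2 : Fin 3), (γ 2 - γ j)) / (γ 2 * (γ 0 * γ 1 * γ 2))
    rw [prod_erase_two_three' (fun j => γ 2 - γ j), map_mul, map_sub, map_sub, hσγ, hσγ, hσγ]
    field_simp; ring

/-- **THE σ-COMPATIBLE LINEAR FAMILY**: for norm-one nodes on `Fin 3`, σ-fixed `dᵢ` and `σ² = 1`, the quotient `(ω + σ(ω)·G·γᵢ) ∕ (dᵢ·Vᵢ)`, `G = γ₀γ₁γ₂`, is σ-FIXED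
(`σ(p(γᵢ)) = p^σ(γᵢ⁻¹) = σω + ω∕(Gγᵢ)`, and `(σω + ω∕(Gγᵢ))·γᵢG = p(γᵢ)`) — so the norm equations `aᵢσ(aᵢ) = p(γᵢ)∕(dᵢVᵢ)` have σ-fixed right-hand sides.
[cite: Jacobowitz1962, §4] [cite: Serre1979, Ch. V §2 Prop. 3] -/
theorem map_linearSymm_div_eq_self (hσσ : ∀ x, σ (σ x) = x) (hσγ : ∀ i, σ (γ i) = (γ i)⁻¹) (hγ0 : ∀ i, γ i ≠ 0) (hinj : Function.Injective γ)
    {d : Fin 3 → K} (hσd : ∀ i, σ (d i) = d i) (ω : K) (i : Fin 3) :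
    σ ((ω + σ ω * (γ 0 * γ 1 * γ 2) * γ i) / (d i * ∏ j ∈ univ.erase i, (γ i - γ j))) =
      (ω + σ ω * (γ 0 * γ 1 * γ 2) * γ i) / (d i * ∏ j ∈ univ.erase i, (γ i - γ j)) := by
  have h0 := hγ0 0; have h1 := hγ0 1; have h2 := hγ0 2; have hi := hγ0 i
  have hV0 : ∏ j ∈ univ.erase i, (γ i - γ j) ≠ 0 :=
    Finset.prod_ne_zero_iff.2 fun j hj => sub_ne_zero.2 fun h => (Finset.ne_of_mem_erase hj) (hinj h).symm
  rcases eq_or_ne (d i) 0 with hd0 | hd0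
  · simp [hd0]
  rw [map_div₀, map_mul, map_nodalDeriv_fin_three σ hσγ hγ0 i, hσd, map_add, map_mul, map_mul, hσσ, map_mul, map_mul, hσγ, hσγ, hσγ, hσγ]
  field_simp
  ring

end NormOne

/-! ## §3 The rationality involution `ι`: `p(γ₀)` is `ι`-fixed, `ι p(γ₁) = p(γ₂)` -/

section Iota

variable {K : Type*} [Field K] (ι : K →+* K) {γ : Fin 3 → K}

/-- **`ι` FIXES the value at the rational node** when `ιγ₀ = γ₀`, `ι` permutes `γ₁, γ₂`, and `ι` fixes the coefficients `ω`, `ω'` (`p(X) = ω + ω'·G·X`). [cite: Rogawski1990, §4.9 Lemma 4.9.3 p. 56] -/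
theorem map_linearSymm_zero (hγ0 : ι (γ 0) = γ 0) (hγ1 : ι (γ 1) = γ 2) (hγ2 : ι (γ 2) = γ 1) {ω ω' : K} (hω : ι ω = ω) (hω' : ι ω' = ω') :
    ι (ω + ω' * (γ 0 * γ 1 * γ 2) * γ 0) = ω + ω' * (γ 0 * γ 1 * γ 2) * γ 0 := by
  simp only [map_add, map_mul, hγ0, hγ1, hγ2, hω, hω']; ring

/-- **`ι` carries the value at `γ₁` to the value at `γ₂`.** [cite: Rogawski1990, §4.9 Lemma 4.9.3 p. 56] -/
theorem map_linearSymm_one (hγ0 : ι (γ 0) = γ 0) (hγ1 : ι (γ 1) = γ 2) (hγ2 : ι (γ 2) = γ 1) {ω ω' : K} (hω : ι ω = ω) (hω' : ι ω' = ω') :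
    ι (ω + ω' * (γ 0 * γ 1 * γ 2) * γ 1) = ω + ω' * (γ 0 * γ 1 * γ 2) * γ 2 := by
  simp only [map_add, map_mul, hγ0, hγ1, hγ2, hω, hω']; ring

/-- The nodal derivatives under `ι`: `ιV₀ = V₀`, `ιV₁ = V₂`. [cite: Rogawski1990, §4.9 Lemma 4.9.3 p. 56] -/
theorem map_nodalDeriv_iota (hγ0 : ι (γ 0) = γ 0) (hγ1 : ι (γ 1) = γ 2) (hγ2 : ι (γ 2) = γ 1) :
    ι (∏ j ∈ univ.erase (0 : Fin 3), (γ 0 - γ j)) = ∏ j ∈ univ.erase (0 : Fin 3), (γ 0 - γ j) ∧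
      ι (∏ j ∈ univ.erase (1 : Fin 3), (γ 1 - γ j)) = ∏ j ∈ univ.erase (2 : Fin 3), (γ 2 - γ j) := by
  rw [prod_erase_zero_three' (fun j => γ 0 - γ j), prod_erase_one_three' (fun j => γ 1 - γ j), prod_erase_two_three' (fun j => γ 2 - γ j),
    map_mul, map_sub, map_sub, map_mul, map_sub, map_sub, hγ0, hγ1, hγ2]
  exact ⟨by ring, by ring⟩

end Iota

end Literature.NumberTheory.Automorphic
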